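import Summits.CriticalPhenomena.PercolationContinuityZ3.Theorems.PercNearOneGluingNoHeavyLowerTailSunflowerPendantBound
import Summits.CriticalPhenomena.PercolationContinuityZ3.Theorems.PercNearOneGluingNoHeavyLowerTailSunflowerUnionEdge
import Summits.CriticalPhenomena.PercolationContinuityZ3.Theorems.PercNearOneGluingNoHeavyLowerTailSunflowerSafeMinors
import HarnessLib

/-!
# `NoHeavyLowerTail` (crux stmt-CriticalPhenomena-4575), abstract sunflower cubic: A-SAFETY IS PRESERVED BY ATTACHING A
# PENDANT VERTEX (a leaf)

Support file (seat `prim-ineq-prove-1` gen 49; `--supports stmt-CriticalPhenomena-4575`).  No `sorry`, no named facts.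
Memo: run/shared/lean/prim/prim-ineq-prove-1/FINDING-PENDANT-prove1-g49.md.

SETTING (`…SunflowerSafeCalculus`, `…SunflowerGradedSafeBlocks`, `…SunflowerSafeMinors`).  `μ = prodBernoulli p` on `Set ι`;
`Safe p A` = Lemma A in product form for every finite family of up-sets meeting pairwise inside `A`; "A-safe" = safe at every
`p`.  The conjecture `TriangleFreeSafe` (G△, `…SunflowerGraphCoreTriangle`/`…SafeMinors`): every triangle-free graph has an
A-safe edge core.  The survey of gen 48 (HOME/SURVEY-SAFETY-prove1-g48.md §3 (O5)) listed PENDANT INVARIANCE — is `Γ` plus a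
leaf A-safe whenever `Γ` is? — as open (census-true; the naive 4-state relaxation of gen 43 is false).  This file proves it.
* **`safe_union_pendant`** (fixed `p`): let `A` be an up-set not depending on the coordinate `z`, and `v ≠ z`.  If `A`, its
  deletion minor `delMinor v A = A|_{v=0}` and its contraction minor `conMinor v A = A|_{v=1}` are safe at `p`, then
  `A ∪ {ω | v ∈ ω ∧ z ∈ ω}` is safe at `p`.
  PROOF.  Condition on the block `{v, z}` (`real_eq_BEx`, `BEx_pair`): a petal `W ⊇ core` has sections of measure `x ≤ 1` (both
  present), `vv` (`v` present, `z` absent; these form a petal system of `conMinor v A`, measure `β`), `u` (`v` absent, `z`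
  present; petal system of `delMinor v A`, measure `b`), `m ≤ min(u, vv)` (both absent); the `z`-absent sections
  `sect {z} {z} W` form a petal system of `A` itself, of measures `(1−s)m + s·vv` (`real_eq_BEx` on the block `{v}`,
  `sect_sect`), `μ A = (1−s)b + sβ`.  The three safety hypotheses are exactly the product hypotheses of the analytic bound
  `Pendant.pendant_prod_le` (`…SunflowerPendantBound`; `pendant_prod_le_zero` when `b = 0`, the sections being then pairwise
  orthogonal by Harris), whose conclusion is `∏ μ(W_j) ≤ (st + s(1−t)β + (1−s)b)^(n−1) = μ(A ∪ {v,z open})^(n−1)`.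
* **`aSafe_union_pendant`**: if `A` (not depending on `z`) is A-safe then so is `A ∪ {v ∈ ω ∧ z ∈ ω}` — the minors of an
  A-safe core are A-safe (`aSafe_delMinor`, `aSafe_conMinor`, `…SunflowerSafeMinors`).
* GRAPH FORM **`aSafe_edgeCore_add_pendant`**: if `z` is isolated in `Γ₀`, `v ≠ z`, and `edgeCore Γ₀` is A-safe, then the core of
  `Γ₀ ⊔ {vz}` — `Γ₀` with a PENDANT EDGE at `v` — is A-safe; `aSafe_edgeCore_add_pendant_comap` (all blow-ups).  Consequences:
  A-safety is preserved by attaching pendant trees anywhere (iterate), so every graph obtained from an A-safe graph (bipartite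
  graphs, Andrásfai graphs and their blow-ups, `C₅`, `C₇`, the certified primes …) by repeatedly hanging leaves is A-safe, and a
  minimal counterexample to G△ has minimum degree `≥ 2` (and is twin-free, `…SunflowerBlowup`).
-/

noncomputable section

namespace Summit.CriticalPhenomena.PercolationContinuityZ3.Theorems.SunflowerPartition

namespace SafeCalc

open MeasureTheory Finset
open Literature.Probability.LatticeModels Literature.Probability.Percolation
open TwoGenCore (wmiss)

variable {ι : Type*} [DecidableEq ι] (p : ι → unitInterval)

namespace Pendant

open UnionEdge

/-! ## Block bookkeeping: a singleton block, nested sections, events not depending on `z` -/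

/-- Block expectation over a singleton: `BEx p {y} F = p_y·F ∅ + (1 − p_y)·F {y}`. [this work] -/
theorem BEx_singleton (y : ι) (F : Finset ι → ℝ) :
    BEx p ({y} : Finset ι) F = (p y : ℝ) * F ∅ + (1 - p y) * F {y} := by
  have hne : (∅ : Finset ι) ≠ {y} := (singleton_ne_empty y).symm
  have hps : ({y} : Finset ι).powerset = {∅, {y}} := by
    ext D; rw [mem_powerset, subset_singleton_iff, mem_insert, mem_singleton]
  unfold BEx
  rw [hps, sum_pair hne]
  unfold TwoGenCore.wmiss
  rw [prod_empty, sdiff_empty, prod_singleton, prod_singleton, sdiff_self, Finset.bot_eq_empty, prod_empty]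
  ring

omit [DecidableEq ι] in
/-- Nested sections along disjoint blocks compose. [this work] -/
theorem sect_sect [DecidableEq ι] {a a' T T' : Finset ι} (hd : Disjoint a a') (hT : T ⊆ a) (hT' : T' ⊆ a')
    (V : Set (Set ι)) : sect a T (sect a' T' V) = sect (a ∪ a') (T ∪ T') V := by
  ext ω
  simp only [sect, Set.mem_setOf_eq]
  have key : ((ω \ (↑a : Set ι)) ∪ ((a \ T : Finset ι) : Set ι)) \ (↑a' : Set ι) ∪ ((a' \ T' : Finset ι) : Set ι) =
      (ω \ (↑(a ∪ a') : Set ι)) ∪ (((a ∪ a') \ (T ∪ T') : Finset ι) : Set ι) := by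
    ext e
    have h1 : e ∈ a → e ∉ a' := fun he he' => Finset.disjoint_left.1 hd he he'
    have h2 : e ∈ T → e ∈ a := fun he => hT he
    have h3 : e ∈ T' → e ∈ a' := fun he => hT' he
    simp only [Set.mem_union, Set.mem_sdiff, Finset.mem_coe, Finset.mem_sdiff, Finset.mem_union]
    tauto
  rw [key]

omit [DecidableEq ι] in
/-- Events not depending on `z`: configurations that agree off `z` agree on `A`. [this work] -/
theorem mem_iff_of_determinedBy {A : Set (Set ι)} {z : ι} (hA : DeterminedBy A (↑({z} : Finset ι) : Set ι)ᶜ)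
    {ω ω' : Set ι} (h : ∀ e, e ≠ z → (e ∈ ω ↔ e ∈ ω')) : ω ∈ A ↔ ω' ∈ A := by
  refine (determinedBy_iff A _).1 hA ω ω' ?_
  ext e
  simp only [Set.mem_inter_iff, Set.mem_compl_iff, Finset.coe_singleton, Set.mem_singleton_iff]
  constructor
  · rintro ⟨h1, h2⟩; exact ⟨(h e h2).1 h1, h2⟩
  · rintro ⟨h1, h2⟩; exact ⟨(h e h2).2 h1, h2⟩

/-- For an event not depending on `z`, the sections along `{v, z}` with `v` absent are the deletion minor at `v` and the
sections with `v` present are the contraction minor at `v`. [this work] -/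
theorem sect_pair_eq_minor [Fintype ι] {v z : ι} {A : Set (Set ι)}
    (hA : DeterminedBy A (↑({z} : Finset ι) : Set ι)ᶜ) :
    sect ({v, z} : Finset ι) {v, z} A = delMinor v A ∧ sect ({v, z} : Finset ι) {v} A = delMinor v A ∧
    sect ({v, z} : Finset ι) {z} A = conMinor v A ∧ sect ({v, z} : Finset ι) ∅ A = conMinor v A := by
  refine ⟨?_, ?_, ?_, ?_⟩ <;> ext ω <;>
    simp only [sect, delMinor, conMinor, secOff, secOn, Set.mem_setOf_eq] <;>
    refine mem_iff_of_determinedBy hA fun e he => ?_ <;>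
    simp only [Set.mem_union, Set.mem_sdiff, Finset.coe_insert, Finset.coe_singleton, Set.mem_insert_iff,
      Set.mem_singleton_iff, Finset.mem_coe, Finset.mem_sdiff, Finset.mem_insert, Finset.mem_singleton,
      Finset.notMem_empty, he, or_false, not_false_eq_true, and_true] <;>
    tauto

/-- The `z`-absent section of `{v, z open}` is empty. [this work] -/
theorem sect_z_pairOpen (v z : ι) : sect ({z} : Finset ι) {z} (pairOpen v z) = ∅ := by
  ext ω
  simp only [sect, pairOpen, Set.mem_setOf_eq, Set.mem_empty_iff_false, iff_false]
  rintro ⟨-, hz⟩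
  rw [sdiff_self, Finset.bot_eq_empty, Finset.coe_empty, Set.union_empty, Finset.coe_singleton] at hz
  exact hz.2 rfl

/-! ## The main theorem -/

/-- **SAFETY IS PRESERVED BY A PENDANT COORDINATE (fixed `p`).**  If the up-set `A` does not depend on `z`, `v ≠ z`, and
`A`, `delMinor v A`, `conMinor v A` are safe at `p`, then `A ∪ {ω | v ∈ ω ∧ z ∈ ω}` is safe at `p`. [this work] -/
theorem safe_union_pendant [Fintype ι] {v z : ι} (hne : v ≠ z) {A : Set (Set ι)}
    (hd : DeterminedBy A (↑({z} : Finset ι) : Set ι)ᶜ) (hu : IsUpperSet A) (hA : Safe p A)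
    (hA0 : Safe p (delMinor v A)) (hA1 : Safe p (conMinor v A)) : Safe p (A ∪ pairOpen v z) := by
  classical
  intro n V hV hcap
  set bk : Finset ι := {v, z} with hbk
  set B : Set (Set ι) := A ∪ pairOpen v z with hB
  have hBup : IsUpperSet B := hu.union (isUpperSet_pairOpen v z)
  -- enlarge the petals so that they contain the core
  set W : Fin n → Set (Set ι) := fun i => V i ∪ B with hW
  have hWup : ∀ i, IsUpperSet (W i) := fun i => (hV i).union hBup
  have hWB : ∀ i, B ⊆ W i := fun i => Set.subset_union_right
  have hWcap : ∀ i j, i ≠ j → W i ∩ W j ⊆ B := by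
    intro i j hij ω hω
    rcases hω with ⟨h1 | h1, h2 | h2⟩
    · exact hcap i j hij ⟨h1, h2⟩
    exacts [h2, h1, h1]
  have hmono : ∀ i, (prodBernoulli p).real (V i) ≤ (prodBernoulli p).real (W i) :=
    fun i => measureReal_mono Set.subset_union_left
  -- sections of the core
  obtain ⟨e0, ez, ev, evz⟩ := sect_pairOpen hne
  obtain ⟨avz, av, az, a0⟩ := sect_pair_eq_minor hd
  have hB0 : sect bk ∅ B = Set.univ := by rw [hB, sect_union, e0, Set.union_univ]
  have hBz : sect bk {z} B = conMinor v A := by rw [hB, sect_union, az, ez, Set.union_empty]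
  have hBv : sect bk {v} B = delMinor v A := by rw [hB, sect_union, av, ev, Set.union_empty]
  have hBvz : sect bk {v, z} B = delMinor v A := by rw [hB, sect_union, avz, evz, Set.union_empty]
  -- notation
  set s : ℝ := ((p v : unitInterval) : ℝ) with hs
  set t : ℝ := ((p z : unitInterval) : ℝ) with ht
  set b : ℝ := (prodBernoulli p).real (delMinor v A) with hbdef
  set β : ℝ := (prodBernoulli p).real (conMinor v A) with hβdef
  have hs0 : 0 ≤ s := (p v).2.1
  have hs1 : s ≤ 1 := (p v).2.2
  have ht0 : 0 ≤ t := (p z).2.1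
  have ht1 : t ≤ 1 := (p z).2.2
  have hb0 : 0 ≤ b := measureReal_nonneg
  have hbβ : b ≤ β := measureReal_mono ((delMinor_subset v hu).trans (subset_conMinor v hu))
  have hβ1 : β ≤ 1 := measureReal_le_one
  -- the measures of the core and of `A`
  have hBval : (prodBernoulli p).real B = s * t + s * (1 - t) * β + (1 - s) * b := by
    rw [real_eq_BEx p bk B, BEx_pair p hne, hB0, hBz, hBv, hBvz, probReal_univ]; ring
  have hAval : (prodBernoulli p).real A = (1 - s) * b + s * β := by
    rw [real_eq_BEx p bk A, BEx_pair p hne, a0, az, av, avz]; ring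
  -- the four section measures of the petals
  set x : Fin n → ℝ := fun i => (prodBernoulli p).real (sect bk ∅ (W i)) with hx
  set vv : Fin n → ℝ := fun i => (prodBernoulli p).real (sect bk {z} (W i)) with hvvdef
  set u : Fin n → ℝ := fun i => (prodBernoulli p).real (sect bk {v} (W i)) with hudef
  set m : Fin n → ℝ := fun i => (prodBernoulli p).real (sect bk {v, z} (W i)) with hmdef
  have hdec : ∀ i, (prodBernoulli p).real (W i) =
      s * t * x i + s * (1 - t) * vv i + (1 - s) * t * u i + (1 - s) * (1 - t) * m i := by
    intro i; rw [real_eq_BEx p bk (W i), BEx_pair p hne]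
  -- bounds
  have hx1 : ∀ i, x i ≤ 1 := fun i => measureReal_le_one
  have hu0 : ∀ i, 0 ≤ u i := fun i => measureReal_nonneg
  have hu1 : ∀ i, u i ≤ 1 := fun i => measureReal_le_one
  have hv1 : ∀ i, vv i ≤ 1 := fun i => measureReal_le_one
  have hm0 : ∀ i, 0 ≤ m i := fun i => measureReal_nonneg
  have hub : ∀ i, b ≤ u i := fun i => by
    have h := sect_mono bk {v} (hWB i); rw [hBv] at h; exact measureReal_mono h
  have hvβ : ∀ i, β ≤ vv i := fun i => by
    have h := sect_mono bk {z} (hWB i); rw [hBz] at h; exact measureReal_mono h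
  have hmb : ∀ i, b ≤ m i := fun i => by
    have h := sect_mono bk {v, z} (hWB i); rw [hBvz] at h; exact measureReal_mono h
  have hmu : ∀ i, m i ≤ u i := fun i =>
    measureReal_mono (sect_anti bk (show ({v} : Finset ι) ⊆ {v, z} by simp) (hWup i))
  have hmv : ∀ i, m i ≤ vv i := fun i =>
    measureReal_mono (sect_anti bk (show ({z} : Finset ι) ⊆ {v, z} by simp) (hWup i))
  have hle : ∀ i, (prodBernoulli p).real (W i) ≤
      s * t + s * (1 - t) * vv i + (1 - s) * t * u i + (1 - s) * (1 - t) * m i := by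
    intro i; rw [hdec i]
    have := mul_le_mul_of_nonneg_left (hx1 i) (mul_nonneg hs0 ht0)
    linarith
  -- the `v`-absent sections form a petal system of `delMinor v A`, the `v`-present ones of `conMinor v A`
  have hcapv : ∀ i j, i ≠ j → sect bk {v} (W i) ∩ sect bk {v} (W j) ⊆ delMinor v A := by
    intro i j hij; rw [← sect_inter, ← hBv]; exact sect_mono bk {v} (hWcap i j hij)
  have hcapz : ∀ i j, i ≠ j → sect bk {z} (W i) ∩ sect bk {z} (W j) ⊆ conMinor v A := by
    intro i j hij; rw [← sect_inter, ← hBz]; exact sect_mono bk {z} (hWcap i j hij)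
  have hpu : ∏ i, u i ≤ b ^ (n - 1) := hA0 n (fun i => sect bk {v} (W i)) (fun i => isUpperSet_sect bk _ (hWup i)) hcapv
  have hpv : ∏ i, vv i ≤ β ^ (n - 1) := hA1 n (fun i => sect bk {z} (W i)) (fun i => isUpperSet_sect bk _ (hWup i)) hcapz
  -- the `z`-absent sections form a petal system of `A`
  set G : Fin n → Set (Set ι) := fun i => sect ({z} : Finset ι) {z} (W i) with hG
  have hGup : ∀ i, IsUpperSet (G i) := fun i => isUpperSet_sect {z} {z} (hWup i)
  have hGcap : ∀ i j, i ≠ j → G i ∩ G j ⊆ A := by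
    intro i j hij
    have h1 : G i ∩ G j ⊆ sect ({z} : Finset ι) {z} B := by
      simp only [hG]; rw [← sect_inter]; exact sect_mono {z} {z} (hWcap i j hij)
    have h2 : sect ({z} : Finset ι) {z} B = A := by
      rw [hB, sect_union, sect_eq_self_of_determinedBy_compl {z} {z} hd, sect_z_pairOpen, Set.union_empty]
    rw [h2] at h1; exact h1
  have hdisj : Disjoint ({v} : Finset ι) {z} := by
    rw [Finset.disjoint_singleton_left, Finset.mem_singleton]; exact hne
  have hGval : ∀ i, (prodBernoulli p).real (G i) = (1 - s) * m i + s * vv i := by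
    intro i
    rw [real_eq_BEx p {v} (G i), BEx_singleton]
    simp only [hG]
    rw [sect_sect hdisj (Finset.empty_subset _) subset_rfl, sect_sect hdisj subset_rfl subset_rfl,
      Finset.empty_union]
    have e1 : ({v} : Finset ι) ∪ {z} = bk := by rw [hbk, Finset.insert_eq]
    rw [e1]
    ring
  have hpg : ∏ i, ((1 - s) * m i + s * vv i) ≤ ((1 - s) * b + s * β) ^ (n - 1) := by
    have h := hA n G hGup hGcap
    rw [Finset.prod_congr rfl fun i _ => hGval i, hAval] at h
    exact h
  -- assemble
  have hgoal : ∏ i, (prodBernoulli p).real (W i) ≤ (prodBernoulli p).real B ^ (n - 1) := by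
    rw [hBval]
    refine le_trans (prod_le_prod (fun i _ => measureReal_nonneg) fun i _ => hle i) ?_
    rcases hb0.lt_or_eq with hbpos | hbzero
    · exact pendant_prod_le hbpos hbβ hs0 hs1 ht0 ht1 u vv m hub hvβ hmb hmu hpu hpv hpg
    · -- `b = 0`: the `v`-absent sections are pairwise orthogonal (Harris)
      have hU2 : ∀ i j, i ≠ j → u i * u j = 0 := by
        intro i j hij
        have h := prodBernoulli_harris p (isUpperSet_sect bk {v} (hWup i)) (isUpperSet_sect bk {v} (hWup j))
          MeasurableSet.of_discrete MeasurableSet.of_discrete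
        have h' := (h.trans (measureReal_mono (hcapv i j hij))).trans_eq hbzero.symm
        exact le_antisymm h' (mul_nonneg (hu0 i) (hu0 j))
      have hV2 : ∀ i j, i ≠ j → vv i * vv j ≤ β := by
        intro i j hij
        have h := prodBernoulli_harris p (isUpperSet_sect bk {z} (hWup i)) (isUpperSet_sect bk {z} (hWup j))
          MeasurableSet.of_discrete MeasurableSet.of_discrete
        exact h.trans (measureReal_mono (hcapz i j hij))
      rw [← hbzero, mul_zero, add_zero]
      exact pendant_prod_le_zero (hb0.trans hbβ) hs0 hs1 ht0 ht1 u vv m hu0 hu1 hvβ hv1 hm0 hmu hmv hU2 hV2 hpv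
  exact le_trans (prod_le_prod (fun i _ => measureReal_nonneg) fun i _ => hmono i) hgoal

/-- **A-SAFETY IS PRESERVED BY A PENDANT COORDINATE**: if `A` does not depend on `z`, `v ≠ z`, and `A` is A-safe, then
`A ∪ {ω | v ∈ ω ∧ z ∈ ω}` is A-safe (the minors of an A-safe core are A-safe, `…SunflowerSafeMinors`). [this work] -/
theorem aSafe_union_pendant [Fintype ι] {v z : ι} (hne : v ≠ z) {A : Set (Set ι)}
    (hd : DeterminedBy A (↑({z} : Finset ι) : Set ι)ᶜ) (hu : IsUpperSet A) (hA : ∀ q, Safe q A)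
    (q : ι → unitInterval) : Safe q (A ∪ pairOpen v z) :=
  safe_union_pendant q hne hd hu (hA q) (aSafe_delMinor hu hA v q) (aSafe_conMinor hu hA v q)

end Pendant

/-! ## Graph form: an A-safe graph plus a pendant edge is A-safe -/

section Graph

open UnionEdge Pendant

omit [DecidableEq ι] in
/-- If `z` is isolated in `Γ₀`, its core does not depend on `z`. [this work] -/
theorem determinedBy_edgeCore_of_isolated_one (Γ₀ : SimpleGraph ι) {z : ι} (hz : ∀ w, ¬ Γ₀.Adj z w) :
    DeterminedBy (edgeCore Γ₀) (↑({z} : Finset ι) : Set ι)ᶜ := by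
  rw [determinedBy_iff]
  have key : ∀ ω ω' : Set ι, ω ∩ (↑({z} : Finset ι) : Set ι)ᶜ = ω' ∩ (↑({z} : Finset ι) : Set ι)ᶜ →
      ω ∈ edgeCore Γ₀ → ω' ∈ edgeCore Γ₀ := by
    rintro ω ω' h ⟨a, c, hac, ha, hc⟩
    have ha' : a ∉ (↑({z} : Finset ι) : Set ι) := by
      rw [Finset.coe_singleton, Set.mem_singleton_iff]; rintro rfl; exact hz c hac
    have hc' : c ∉ (↑({z} : Finset ι) : Set ι) := by
      rw [Finset.coe_singleton, Set.mem_singleton_iff]; rintro rfl; exact hz a hac.symm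
    have ea := (Set.ext_iff.1 h a).1 ⟨ha, ha'⟩
    have ec := (Set.ext_iff.1 h c).1 ⟨hc, hc'⟩
    exact ⟨a, c, hac, ea.1, ec.1⟩
  exact fun ω ω' h => ⟨key ω ω' h, key ω' ω h.symm⟩

/-- **An A-safe graph plus a pendant edge is A-safe**: if `z` is isolated in `Γ₀`, `v ≠ z`, and `edgeCore Γ₀` is A-safe, then
the core of `Γ₀ ⊔ {vz}` (the leaf `z` hung at `v`) is A-safe. [this work] -/
theorem aSafe_edgeCore_add_pendant [Fintype ι] (Γ₀ : SimpleGraph ι) {v z : ι} (hne : v ≠ z) (hz : ∀ w, ¬ Γ₀.Adj z w)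
    (hsafe : ∀ q : ι → unitInterval, Safe q (edgeCore Γ₀)) (p' : ι → unitInterval) :
    Safe p' (edgeCore (Γ₀ ⊔ SimpleGraph.fromEdgeSet {s(v, z)})) := by
  classical
  rw [edgeCore_sup_edge Γ₀ hne]
  exact aSafe_union_pendant hne (determinedBy_edgeCore_of_isolated_one Γ₀ hz) (isUpperSet_edgeCore Γ₀) hsafe p'

/-- **Blow-ups**: every pull-back `(Γ₀ ⊔ {vz}).comap f` of an A-safe graph plus a pendant edge has an A-safe core
(`aSafe_edgeCore_comap`, `…SunflowerBlowup`). [this work] -/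
theorem aSafe_edgeCore_add_pendant_comap [Fintype ι] {κ : Type*} [Fintype κ] (f : κ → ι) (Γ₀ : SimpleGraph ι)
    {v z : ι} (hne : v ≠ z) (hz : ∀ w, ¬ Γ₀.Adj z w) (hsafe : ∀ q : ι → unitInterval, Safe q (edgeCore Γ₀))
    (p' : κ → unitInterval) : Safe p' (edgeCore ((Γ₀ ⊔ SimpleGraph.fromEdgeSet {s(v, z)}).comap f)) :=
  aSafe_edgeCore_comap f _ (fun q => aSafe_edgeCore_add_pendant Γ₀ hne hz hsafe q) p'

end Graph

end SafeCalc

end Summit.CriticalPhenomena.PercolationContinuityZ3.Theorems.SunflowerPartition
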